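import Mathlib
import Literature.RepresentationTheory.FiniteGroups.GLnUnipotent
import Literature.RepresentationTheory.FiniteGroups.GLnBruhat
import Literature.Barriers.HubbardSuperconductivity.SourcedOrderWithoutGroundStateLROKomaTasakiClass
import Summits.MatrixMultiplication.MatrixMultiplication.Theorems.SubgroupIdentityDesigns.Negative.ParabolicSubgroup

/-!
# Bruhat representatives for the double cosets `P_c \ GL_N(F) / P_j`

Support file toward the maximal-parabolic Mackey formula `SteinbergTower.MackeyFormula`
(crux `SubgroupIdentityDesigns`, negative side; VALUE = reusable linear-algebra bookkeeping,
NOT summit progress).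

For the maximal parabolics `P_c = parab F N c`, `P_j = parab F N j` of `GL_N(F)`
(`ParabolicSubgroup`) we prove that every `s ∈ GL_N(F)` lies in a double coset
`P_c · w(π_i) · P_j` of an explicit **block-swap permutation matrix** `w(π_i)`
(`swapPerm N c j i`: the identity on `[0,i)` and `[c+j-i,N)`, `[i,j) ↦ [c,c+j-i)`,
`[j,c+j-i) ↦ [i,c)`), for some `i ≤ min(c,j)` with `c + j ≤ N + i` (`exists_swap_dcoset`):
Bruhat (`GLn.exists_bruhat`: `s = u₁⁻¹ w(σ) d u₂⁻¹`) puts `s` in `P_c w(σ) P_j`, and two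
permutations with the same count `#{x < j : σ x < c}` differ by block-preserving permutations
(`exists_blockPerm`, matching the four fibres of `x ↦ ([x<j],[σ x<c])`), whose matrices lie in
`P_c`, `P_j`.  [folklore; Bruhat decomposition for `(P_c, P_j)`]
-/

set_option linter.dupNamespace false
set_option maxHeartbeats 800000

noncomputable section

open scoped BigOperators Classical
open Literature.RepresentationTheory.FiniteGroups

namespace Summit.MatrixMultiplication.MatrixMultiplication.Theorems.SubgroupIdentityDesigns.Negative

namespace ParabolicBruhat

open ParabolicSubgroup
open Literature.Barriers.HubbardSuperconductivity.VanishingFieldSpins (card_filter_val_lt)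

variable {F : Type} [Field F] [Fintype F] [DecidableEq F] {N c j : ℕ}

/-! ## Permutation matrices in `GL_N(F)` -/

omit [Fintype F] [DecidableEq F] in
/-- `w(σ)⁻¹ w(σ) = 1` for the `PEquiv` matrices. -/
theorem toMatrix_inv_mul (σ : Equiv.Perm (Fin N)) :
    ((σ⁻¹).toPEquiv.toMatrix : Matrix (Fin N) (Fin N) F) * σ.toPEquiv.toMatrix = 1 := by
  rw [← PEquiv.toMatrix_trans, ← Equiv.toPEquiv_trans, Equiv.Perm.inv_def, Equiv.symm_trans_self,
    Equiv.toPEquiv_refl, PEquiv.toMatrix_refl]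

/-- The permutation matrix `w(σ) ∈ GL_N(F)`, `w(σ)_{st} = [s = σ t]` (`w(σ) e_t = e_{σ t}`). -/
def permGL (σ : Equiv.Perm (Fin N)) : GL (Fin N) F where
  val := (σ⁻¹).toPEquiv.toMatrix
  inv := σ.toPEquiv.toMatrix
  val_inv := toMatrix_inv_mul σ
  inv_val := by simpa only [inv_inv] using toMatrix_inv_mul (F := F) σ⁻¹

omit [Fintype F] [DecidableEq F] in
/-- Entries of `w(σ)`. -/
theorem permGL_apply (σ : Equiv.Perm (Fin N)) (s t : Fin N) :
    ((permGL σ : GL (Fin N) F) : Matrix (Fin N) (Fin N) F) s t = if s = σ t then 1 else 0 := by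
  show ((σ⁻¹).toPEquiv.toMatrix : Matrix (Fin N) (Fin N) F) s t = _
  simp only [PEquiv.toMatrix_apply, Equiv.toPEquiv_apply, Option.mem_def, Option.some.injEq,
    Equiv.Perm.inv_def, Equiv.symm_apply_eq]

omit [Fintype F] [DecidableEq F] in
/-- `σ ↦ w(σ)` is multiplicative. -/
theorem permGL_mul (α β : Equiv.Perm (Fin N)) :
    (permGL (α * β) : GL (Fin N) F) = permGL α * permGL β := by
  refine Units.ext ?_
  show (((α * β)⁻¹).toPEquiv.toMatrix : Matrix (Fin N) (Fin N) F) =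
      (α⁻¹).toPEquiv.toMatrix * (β⁻¹).toPEquiv.toMatrix
  rw [mul_inv_rev, Equiv.Perm.mul_def, Equiv.toPEquiv_trans, PEquiv.toMatrix_trans]

omit [Fintype F] [DecidableEq F] in
/-- `w(1) = 1`. -/
theorem permGL_one : (permGL (1 : Equiv.Perm (Fin N)) : GL (Fin N) F) = 1 := by
  refine Units.ext ?_
  show (((1 : Equiv.Perm (Fin N)))⁻¹.toPEquiv.toMatrix : Matrix (Fin N) (Fin N) F) = 1
  rw [inv_one, Equiv.Perm.one_def, Equiv.toPEquiv_refl, PEquiv.toMatrix_refl]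

omit [Fintype F] [DecidableEq F] in
/-- `w(σ)⁻¹ = w(σ⁻¹)`. -/
theorem permGL_inv (σ : Equiv.Perm (Fin N)) : (permGL σ : GL (Fin N) F)⁻¹ = permGL σ⁻¹ :=
  inv_eq_of_mul_eq_one_right (by rw [← permGL_mul, mul_inv_cancel, permGL_one])

omit [Fintype F] [DecidableEq F] in
/-- `(w(σ) M)_{st} = M_{σ⁻¹ s, t}`. -/
theorem permGL_mul_apply (σ : Equiv.Perm (Fin N)) (M : Matrix (Fin N) (Fin N) F) (s t : Fin N) :
    (((permGL σ : GL (Fin N) F) : Matrix (Fin N) (Fin N) F) * M) s t = M (σ⁻¹ s) t := by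
  rw [Matrix.mul_apply, Finset.sum_eq_single (σ⁻¹ s)]
  · have hs : s = σ (σ⁻¹ s) := (σ.apply_symm_apply s).symm
    rw [permGL_apply, if_pos hs, one_mul]
  · intro x _ hx
    rw [permGL_apply, if_neg, zero_mul]
    intro h
    exact hx (by rw [h]; exact (σ.symm_apply_apply x).symm)
  · intro h
    exact absurd (Finset.mem_univ _) h

omit [Fintype F] [DecidableEq F] in
/-- `(M w(σ))_{st} = M_{s, σ t}`. -/
theorem mul_permGL_apply (σ : Equiv.Perm (Fin N)) (M : Matrix (Fin N) (Fin N) F) (s t : Fin N) :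
    (M * ((permGL σ : GL (Fin N) F) : Matrix (Fin N) (Fin N) F)) s t = M s (σ t) := by
  rw [Matrix.mul_apply, Finset.sum_eq_single (σ t)]
  · rw [permGL_apply, if_pos rfl, mul_one]
  · intro x _ hx
    rw [permGL_apply, if_neg hx, mul_zero]
  · intro h
    exact absurd (Finset.mem_univ _) h

omit [Fintype F] [DecidableEq F] in
/-- **Conjugation by a permutation matrix permutes entries**:
`(w(σ)⁻¹ g w(σ))_{ab} = g_{σ a, σ b}`. -/
theorem conj_permGL_apply (σ : Equiv.Perm (Fin N)) (g : GL (Fin N) F) (a b : Fin N) :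
    (((permGL σ : GL (Fin N) F)⁻¹ * g * permGL σ : GL (Fin N) F) : Matrix (Fin N) (Fin N) F) a b =
      (g : Matrix (Fin N) (Fin N) F) (σ a) (σ b) := by
  rw [permGL_inv, Units.val_mul, Units.val_mul, mul_permGL_apply, permGL_mul_apply, inv_inv]

/-- **A `c`-block-preserving permutation matrix lies in `P_c`.** -/
theorem permGL_mem_parab {α : Equiv.Perm (Fin N)}
    (hα : ∀ x, ((α x : Fin N) : ℕ) < c ↔ (x : ℕ) < c) : (permGL α : GL (Fin N) F) ∈ parab F N c := by
  intro s t ht hs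
  rw [permGL_apply, if_neg]
  intro h
  have h1 : ((α t : Fin N) : ℕ) < c := (hα t).mpr ht
  rw [← h] at h1
  omega

/-- **Upper unitriangular matrices lie in every `P_c`.** -/
theorem unitUpper_le_parab : GLn.unitUpper F N ≤ parab F N c := by
  intro g hg s t ht hs
  exact hg.1 _ _ (by rw [Fin.lt_def]; omega)

/-! ## Bruhat: `s ∈ P_c w(σ) P_j` -/

/-- **Bruhat form**: every `s ∈ GL_N(F)` is `p w(σ) q` with `p ∈ P_c`, `q ∈ P_j`
(`s = u₁⁻¹ · w(σ) · (d u₂⁻¹)` from `GLn.exists_bruhat`). -/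
theorem exists_perm_dcoset (s : GL (Fin N) F) :
    ∃ (σ : Equiv.Perm (Fin N)), ∃ p ∈ parab F N c, ∃ q ∈ parab F N j,
      s = p * permGL σ * q := by
  obtain ⟨u₁, hu₁, u₂, hu₂, σ, d, hm⟩ := GLn.exists_bruhat s
  have hD : (permGL σ : GL (Fin N) F)⁻¹ * (u₁ * s * u₂) ∈ parab F N j := by
    intro a b hb ha
    rw [permGL_inv, Units.val_mul, permGL_mul_apply, inv_inv, hm, if_neg]
    intro h
    have : a = b := σ.injective h
    omega
  refine ⟨σ, u₁⁻¹, (parab F N c).inv_mem (unitUpper_le_parab hu₁),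
    (permGL σ : GL (Fin N) F)⁻¹ * (u₁ * s * u₂) * u₂⁻¹,
    (parab F N j).mul_mem hD ((parab F N j).inv_mem (unitUpper_le_parab hu₂)), ?_⟩
  group

/-! ## The count `#{x < j : σ x < c}` and block-preserving corrections -/

/-- The pattern `x ↦ ([x < j], [σ x < c])`. -/
def pat (c j : ℕ) (σ : Equiv.Perm (Fin N)) (x : Fin N) : Bool × Bool :=
  (decide ((x : ℕ) < j), decide (((σ x : Fin N) : ℕ) < c))

/-- Fibre sizes of the pattern. -/
def cnt (c j : ℕ) (σ : Equiv.Perm (Fin N)) (b : Bool × Bool) : ℕ :=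
  (Finset.univ.filter fun x : Fin N => pat c j σ x = b).card

/- `#{x ∈ Fin N : x < i} = i` for `i ≤ N` is the landed
`Literature.Barriers.HubbardSuperconductivity.VanishingFieldSpins.card_filter_val_lt` (reused). -/

/-- `#{x : σ x < i} = #{x : x < i}`. -/
theorem card_filter_perm_lt (σ : Equiv.Perm (Fin N)) (i : ℕ) :
    (Finset.univ.filter fun x : Fin N => ((σ x : Fin N) : ℕ) < i).card =
      (Finset.univ.filter fun x : Fin N => (x : ℕ) < i).card := by
  have h : (Finset.univ.filter fun y : Fin N => (y : ℕ) < i) =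
      (Finset.univ.filter fun x : Fin N => ((σ x : Fin N) : ℕ) < i).map σ.toEmbedding := by
    conv_lhs => rw [← Finset.map_univ_equiv σ, Finset.filter_map]
    rfl
  rw [h, Finset.card_map]

/-- Row sum: `cnt(t,t) + cnt(t,f) = #{x < j}`. -/
theorem cnt_tt_add_tf (σ : Equiv.Perm (Fin N)) :
    cnt c j σ (true, true) + cnt c j σ (true, false) =
      (Finset.univ.filter fun x : Fin N => (x : ℕ) < j).card := by
  have h := Finset.card_filter_add_card_filter_not
    (s := Finset.univ.filter fun x : Fin N => (x : ℕ) < j)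
    (fun x : Fin N => ((σ x : Fin N) : ℕ) < c)
  rw [Finset.filter_filter, Finset.filter_filter] at h
  have e1 : (Finset.univ.filter fun x : Fin N => pat c j σ x = (true, true)) =
      Finset.univ.filter fun x : Fin N => (x : ℕ) < j ∧ ((σ x : Fin N) : ℕ) < c := by
    ext x; simp [pat]
  have e2 : (Finset.univ.filter fun x : Fin N => pat c j σ x = (true, false)) =
      Finset.univ.filter fun x : Fin N => (x : ℕ) < j ∧ ¬ ((σ x : Fin N) : ℕ) < c := by
    ext x; simp [pat]
  unfold cnt
  rw [e1, e2]
  exact h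

/-- Column sum: `cnt(t,t) + cnt(f,t) = #{x < c}`. -/
theorem cnt_tt_add_ft (σ : Equiv.Perm (Fin N)) :
    cnt c j σ (true, true) + cnt c j σ (false, true) =
      (Finset.univ.filter fun x : Fin N => (x : ℕ) < c).card := by
  have h := Finset.card_filter_add_card_filter_not
    (s := Finset.univ.filter fun x : Fin N => ((σ x : Fin N) : ℕ) < c)
    (fun x : Fin N => (x : ℕ) < j)
  rw [Finset.filter_filter, Finset.filter_filter, card_filter_perm_lt] at h
  have e1 : (Finset.univ.filter fun x : Fin N => pat c j σ x = (true, true)) =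
      Finset.univ.filter fun x : Fin N => ((σ x : Fin N) : ℕ) < c ∧ (x : ℕ) < j := by
    ext x; simp only [Finset.mem_filter, Finset.mem_univ, true_and, pat, Prod.mk.injEq,
      decide_eq_true_eq]; tauto
  have e2 : (Finset.univ.filter fun x : Fin N => pat c j σ x = (false, true)) =
      Finset.univ.filter fun x : Fin N => ((σ x : Fin N) : ℕ) < c ∧ ¬ (x : ℕ) < j := by
    ext x; simp only [Finset.mem_filter, Finset.mem_univ, true_and, pat, Prod.mk.injEq,
      decide_eq_true_eq, decide_eq_false_iff_not]; tauto
  unfold cnt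
  rw [e1, e2]
  exact h

/-- Total: the four fibres partition `Fin N`. -/
theorem cnt_sum (σ : Equiv.Perm (Fin N)) :
    cnt c j σ (true, true) + cnt c j σ (true, false) + cnt c j σ (false, true) +
      cnt c j σ (false, false) = N := by
  have h := Finset.card_eq_sum_card_fiberwise (s := (Finset.univ : Finset (Fin N)))
    (t := (Finset.univ : Finset (Bool × Bool))) (f := pat c j σ) (fun _ _ => Finset.mem_univ _)
  rw [Finset.card_univ, Fintype.card_fin, Fintype.sum_prod_type] at h
  simp only [Fintype.sum_bool] at h
  unfold cnt
  omega

/-- **Admissibility of the count**: `i = cnt(t,t)` satisfies `i ≤ c`, `i ≤ j`, `c + j ≤ N + i`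
(when `c, j ≤ N`). -/
theorem cnt_admissible (hc : c ≤ N) (hj : j ≤ N) (σ : Equiv.Perm (Fin N)) :
    cnt c j σ (true, true) ≤ c ∧ cnt c j σ (true, true) ≤ j ∧
      c + j ≤ N + cnt c j σ (true, true) := by
  have h1 := cnt_tt_add_tf (c := c) (j := j) σ
  have h2 := cnt_tt_add_ft (c := c) (j := j) σ
  have h3 := cnt_sum (c := c) (j := j) σ
  rw [card_filter_val_lt hj] at h1
  rw [card_filter_val_lt hc] at h2
  omega

/-- Equal count ⇒ all four fibre sizes agree. -/
theorem cnt_eq_of_tt {σ σ' : Equiv.Perm (Fin N)}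
    (h : cnt c j σ (true, true) = cnt c j σ' (true, true)) (b : Bool × Bool) :
    cnt c j σ b = cnt c j σ' b := by
  have h1 := cnt_tt_add_tf (c := c) (j := j) σ
  have h1' := cnt_tt_add_tf (c := c) (j := j) σ'
  have h2 := cnt_tt_add_ft (c := c) (j := j) σ
  have h2' := cnt_tt_add_ft (c := c) (j := j) σ'
  have h3 := cnt_sum (c := c) (j := j) σ
  have h3' := cnt_sum (c := c) (j := j) σ'
  obtain ⟨a, b⟩ := b
  cases a <;> cases b <;> omega

/-- **Block-preserving corrections**: permutations with the same count differ by a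
`c`-block-preserving permutation on the left and a `j`-block-preserving one on the right. -/
theorem exists_blockPerm {σ σ' : Equiv.Perm (Fin N)}
    (h : cnt c j σ (true, true) = cnt c j σ' (true, true)) :
    ∃ α β : Equiv.Perm (Fin N), (∀ x, ((α x : Fin N) : ℕ) < c ↔ (x : ℕ) < c) ∧
      (∀ x, ((β x : Fin N) : ℕ) < j ↔ (x : ℕ) < j) ∧ σ' = α * σ * β := by
  have hcard : ∀ b : Bool × Bool,
      Fintype.card {x : Fin N // pat c j σ' x = b} = Fintype.card {x : Fin N // pat c j σ x = b} :=
    fun b => by simp only [Fintype.card_subtype]; exact (cnt_eq_of_tt h b).symm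
  let β : Equiv.Perm (Fin N) := Equiv.ofFiberEquiv (f := pat c j σ') (g := pat c j σ) fun b =>
      Fintype.equivOfCardEq (hcard b)
  have hβ : ∀ x, pat c j σ (β x) = pat c j σ' x := fun x => Equiv.ofFiberEquiv_map _ x
  have hβ1 : ∀ x, ((β x : Fin N) : ℕ) < j ↔ (x : ℕ) < j := fun x => by
    have := congrArg Prod.fst (hβ x)
    simpa only [pat, decide_eq_decide] using this
  have hβ2 : ∀ x, (((σ (β x)) : Fin N) : ℕ) < c ↔ ((σ' x : Fin N) : ℕ) < c := fun x => by
    have := congrArg Prod.snd (hβ x)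
    simpa only [pat, decide_eq_decide] using this
  refine ⟨σ' * β⁻¹ * σ⁻¹, β, fun y => ?_, hβ1, by group⟩
  have h2 := hβ2 (β⁻¹ (σ⁻¹ y))
  rw [show β (β⁻¹ (σ⁻¹ y)) = σ⁻¹ y from β.apply_symm_apply _,
    show σ (σ⁻¹ y) = y from σ.apply_symm_apply _] at h2
  simp only [Equiv.Perm.mul_apply]
  exact h2.symm

/-- Same count ⇒ same double coset: `w(σ') ∈ P_c w(σ) P_j`. -/
theorem permGL_mem_dcoset {σ σ' : Equiv.Perm (Fin N)}
    (h : cnt c j σ (true, true) = cnt c j σ' (true, true)) :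
    ∃ p ∈ parab F N c, ∃ q ∈ parab F N j, (permGL σ' : GL (Fin N) F) = p * permGL σ * q := by
  obtain ⟨α, β, hα, hβ, rfl⟩ := exists_blockPerm h
  exact ⟨permGL α, permGL_mem_parab hα, permGL β, permGL_mem_parab hβ, by
    rw [permGL_mul, permGL_mul]⟩

/-! ## The block-swap permutation `π_i` -/

/-- The block swap on `ℕ`: identity on `[0,i)` and `[c+j-i, ∞)`, `[i,j) ↦ [c, c+j-i)`,
`[j, c+j-i) ↦ [i, c)`. -/
def swapFun (c j i x : ℕ) : ℕ :=
  if x < i then x else if x < j then x + (c - i) else if x < c + j - i then x - (j - i) else x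

/-- Its inverse. -/
def swapInv (c j i y : ℕ) : ℕ :=
  if y < i then y else if y < c then y + (j - i) else if y < c + j - i then y - (c - i) else y

/-- `swapInv ∘ swapFun = id` (for admissible `i`). -/
theorem swapInv_swapFun {i : ℕ} (hic : i ≤ c) (hij : i ≤ j) (x : ℕ) :
    swapInv c j i (swapFun c j i x) = x := by
  unfold swapFun swapInv
  split_ifs <;> omega

/-- `swapFun ∘ swapInv = id` (for admissible `i`). -/
theorem swapFun_swapInv {i : ℕ} (hic : i ≤ c) (hij : i ≤ j) (y : ℕ) :
    swapFun c j i (swapInv c j i y) = y := by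
  unfold swapFun swapInv
  split_ifs <;> omega

/-- `swapFun` preserves `[0, N)` when `c + j ≤ N + i`. -/
theorem swapFun_lt {i : ℕ} (hic : i ≤ c) (_hij : i ≤ j) (h : c + j ≤ N + i) {x : ℕ} (hx : x < N) :
    swapFun c j i x < N := by
  unfold swapFun
  split_ifs <;> omega

/-- `swapInv` preserves `[0, N)` when `c ≤ N`. -/
theorem swapInv_lt {i : ℕ} (_hic : i ≤ c) (hij : i ≤ j) (_hc : c ≤ N) (h : c + j ≤ N + i) {y : ℕ}
    (hy : y < N) : swapInv c j i y < N := by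
  unfold swapInv
  split_ifs <;> omega

/-- **The block-swap permutation `π_i` of `Fin N`** (the identity when `i` is not admissible,
i.e. unless `i ≤ c ≤ N`, `i ≤ j` and `c + j ≤ N + i`). -/
def swapPerm (N c j i : ℕ) : Equiv.Perm (Fin N) :=
  if h : i ≤ c ∧ i ≤ j ∧ c ≤ N ∧ c + j ≤ N + i then
    { toFun := fun x => ⟨swapFun c j i x, swapFun_lt h.1 h.2.1 h.2.2.2 x.2⟩
      invFun := fun y => ⟨swapInv c j i y, swapInv_lt h.1 h.2.1 h.2.2.1 h.2.2.2 y.2⟩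
      left_inv := fun x => Fin.ext (swapInv_swapFun h.1 h.2.1 x)
      right_inv := fun y => Fin.ext (swapFun_swapInv h.1 h.2.1 y) }
  else 1

/-- Values of `π_i` (admissible case). -/
theorem swapPerm_val {i : ℕ} (hic : i ≤ c) (hij : i ≤ j) (hc : c ≤ N) (h : c + j ≤ N + i)
    (x : Fin N) : ((swapPerm N c j i x : Fin N) : ℕ) = swapFun c j i x := by
  unfold swapPerm
  rw [dif_pos ⟨hic, hij, hc, h⟩]
  rfl

/-- Values of `π_i⁻¹` (admissible case). -/
theorem swapPerm_symm_val {i : ℕ} (hic : i ≤ c) (hij : i ≤ j) (hc : c ≤ N) (h : c + j ≤ N + i)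
    (y : Fin N) : (((swapPerm N c j i)⁻¹ y : Fin N) : ℕ) = swapInv c j i y := by
  unfold swapPerm
  rw [dif_pos ⟨hic, hij, hc, h⟩]
  rfl

/-- **The count of `π_i` is `i`.** -/
theorem cnt_swapPerm {i : ℕ} (hic : i ≤ c) (hij : i ≤ j) (hc : c ≤ N) (h : c + j ≤ N + i) :
    cnt c j (swapPerm N c j i) (true, true) = i := by
  unfold cnt
  have e : (Finset.univ.filter fun x : Fin N => pat c j (swapPerm N c j i) x = (true, true)) =
      Finset.univ.filter fun x : Fin N => (x : ℕ) < i := by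
    ext x
    simp only [Finset.mem_filter, Finset.mem_univ, true_and, pat, Prod.mk.injEq,
      decide_eq_true_eq, swapPerm_val hic hij hc h]
    unfold swapFun
    constructor
    · rintro ⟨h1, h2⟩
      split_ifs at h2 <;> omega
    · intro hx
      rw [if_pos hx]
      omega
  rw [e, card_filter_val_lt (by omega)]

/-! ## Every element lies in some `P_c w(π_i) P_j` -/

/-- **Double-coset representatives**: every `s ∈ GL_N(F)` (`c, j ≤ N`) lies in
`P_c · w(π_i) · P_j` for an admissible `i` — namely `i = #{x < j : σ x < c}` for the Bruhat
permutation `σ` of `s`. -/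
theorem exists_swap_dcoset (hc : c ≤ N) (hj : j ≤ N) (s : GL (Fin N) F) :
    ∃ i : ℕ, i ≤ c ∧ i ≤ j ∧ c + j ≤ N + i ∧
      ∃ p ∈ parab F N c, ∃ q ∈ parab F N j, s = p * permGL (swapPerm N c j i) * q := by
  obtain ⟨σ, p, hp, q, hq, rfl⟩ := exists_perm_dcoset (c := c) (j := j) s
  obtain ⟨h1, h2, h3⟩ := cnt_admissible hc hj σ
  refine ⟨cnt c j σ (true, true), h1, h2, h3, ?_⟩
  obtain ⟨p', hp', q', hq', e⟩ :=
    permGL_mem_dcoset (F := F) ((cnt_swapPerm h1 h2 hc h3).trans rfl :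
      cnt c j (swapPerm N c j (cnt c j σ (true, true))) (true, true) = cnt c j σ (true, true))
  refine ⟨p * p', (parab F N c).mul_mem hp hp', q' * q, (parab F N j).mul_mem hq' hq, ?_⟩
  rw [e]
  group

end ParabolicBruhat

end Summit.MatrixMultiplication.MatrixMultiplication.Theorems.SubgroupIdentityDesigns.Negative

end
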